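import Literature.NumberTheory.EllipticCurves.ZpExtensionRestrict
import HarnessLib

set_option autoImplicit false

/-!
# Layers of a restricted `ℤ_p`-extension: `Gal(L̄/L_n) = res⁻¹ Gal(K̄/K_n)` and `K_n ↪ L_n`

Topic `Literature/NumberTheory/EllipticCurves` (companion of `ZpExtensionRestrict.lean`).  THEOREM-ONLY file (no
definition, no named fact, no `sorry`), written by the literature seat `bsd-potss-conjA-anchor` g10 (cell
`bsd-potss`; supports stmt-BirchSwinnertonDyer-19386 / 19413): second step of the tower identification
`(L^H)_n = (L_n)^H` displayed in `Literature/NumberTheory/IwasawaTheory/ClassicalMuVanishesDescent.lean`.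
For a `ℤ_p`-extension `κ` of `K`, an extension `L/K` with `κ ∘ res` surjective and `κ_L = κ.restrict L h`
(the tower `L·K_∞/L`):

* `layerSubgroup_restrict` — `Gal(L̄/L_n) = res⁻¹(Gal(K̄/K_n))`, i.e. `κ_L.layerSubgroup n = (κ.layerSubgroup n).comap res`
  (both are `κ⁻¹(pⁿℤ_p)` pulled back);
* `absClosureEmbedding_mem_layer_restrict` — the chosen embedding `ι : K̄ → L̄` (along which `res` is
  defined, `ι(res σ • x) = σ • ι x`) maps `K_n` into `L_n`;
* `exists_algHom_layer_restrict` — hence a `K`-algebra homomorphism `K_n →ₐ[K] L_n` over `ι`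
  (`L_n ⊇ ι(K_n)·L`, the layer `K_n` of the base sits inside the layer `L_n = L·K_n` of `L·K_∞/L`).

* `finrank_layer_restrict`, `finrank_fieldRange_layer_restrict` — `[L_n : K] = [L:K]·pⁿ` and `[L_n : φ K_n] = [L:K]`
  for any `K`-embedding `φ : K_n →ₐ[K] L_n` (degree half of `L_n = L·K_n`).

The Galois identification `Gal(L_n/K_n) ≅ Gal(L/K)` for `p ∤ [L:K]` is NOT in this file.  Reference: [Washington1997] §13.1 (`K_∞L/L`, its layers `LK_n`).
-/

noncomputable section

open Field Literature.NumberTheory.GaloisRepresentations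

universe u v

namespace Literature.NumberTheory.EllipticCurves.ZpExtension

variable {K : Type u} [Field K] [NumberField K] {p : ℕ} [Fact p.Prime]

omit [NumberField K] in
/-- Membership in a layer: `x ∈ K_n ↔ τ • x = x` for all `τ ∈ κ⁻¹(pⁿℤ_p)` (unfolding `IntermediateField.fixedField`
through the identity `absoluteGaloisGroup.toAlgEquiv`). [folklore] -/
private theorem mem_layer_iff' (κ : ZpExtension K p) (n : ℕ) (x : AlgebraicClosure K) :
    x ∈ κ.layer n ↔ ∀ τ ∈ κ.layerSubgroup n, τ • x = x := by
  rw [layer, IntermediateField.mem_fixedField_iff]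
  constructor
  · intro h τ hτ
    exact h _ ⟨τ, hτ, rfl⟩
  · rintro h f ⟨τ, hτ, rfl⟩
    exact h τ hτ

omit [NumberField K] in
/-- **`Gal(L̄/L_n) = res⁻¹ Gal(K̄/K_n)`**: the `n`-th layer subgroup of the restricted extension `L·K_∞/L` is the
preimage of that of `K_∞/K` under `res : Γ_L → Γ_K` (both are `(κ ∘ ·)⁻¹(pⁿℤ_p)`). [cite: Washington1997, §13.1] -/
theorem layerSubgroup_restrict (κ : ZpExtension K p) (L : Type v) [Field L] [NumberField L] [Algebra K L]
    (h : Function.Surjective (κ.toContinuousMonoidHom.comp (absGaloisRestrict K L))) (n : ℕ) :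
    (κ.restrict L h).layerSubgroup n = (κ.layerSubgroup n).comap (absGaloisRestrict K L).toMonoidHom := by
  ext σ
  rw [mem_layerSubgroup, Subgroup.mem_comap, mem_layerSubgroup, restrict_apply]
  rfl

omit [NumberField K] in
/-- **`ι(K_n) ⊆ L_n`**: the chosen embedding `ι : K̄ → L̄` maps the `n`-th layer of `K_∞/K` into the `n`-th layer of
`L·K_∞/L` — for `τ ∈ Gal(L̄/L_n) = res⁻¹ Gal(K̄/K_n)` and `x ∈ K_n`, `τ • ι x = ι(res τ • x) = ι x`.
[cite: Washington1997, §13.1] -/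
theorem absClosureEmbedding_mem_layer_restrict (κ : ZpExtension K p) (L : Type v) [Field L] [NumberField L]
    [Algebra K L] (h : Function.Surjective (κ.toContinuousMonoidHom.comp (absGaloisRestrict K L))) (n : ℕ)
    {x : AlgebraicClosure K} (hx : x ∈ κ.layer n) :
    absClosureEmbedding K L x ∈ (κ.restrict L h).layer n := by
  rw [mem_layer_iff'] at hx ⊢
  intro τ hτ
  rw [layerSubgroup_restrict, Subgroup.mem_comap] at hτ
  rw [← absGaloisRestrict_apply_smul]
  exact congrArg _ (hx _ hτ)

/-- **`K_n →ₐ[K] L_n` over `ι`**: the layer `K_n` of the base embeds `K`-linearly into the layer `L_n` of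
`L·K_∞/L`, by the restriction of the chosen embedding `ι : K̄ → L̄` (`L_n ⊇ L·ι(K_n)`).
[cite: Washington1997, §13.1] -/
theorem exists_algHom_layer_restrict (κ : ZpExtension K p) (L : Type v) [Field L] [NumberField L]
    [Algebra K L] (h : Function.Surjective (κ.toContinuousMonoidHom.comp (absGaloisRestrict K L))) (n : ℕ) :
    ∃ φ : κ.layer n →ₐ[K] (κ.restrict L h).layer n,
      Function.Injective φ ∧ ∀ x : κ.layer n, ((φ x : (κ.restrict L h).layer n) : AlgebraicClosure L) =
        absClosureEmbedding K L (x : AlgebraicClosure K) := by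
  let φ : κ.layer n →ₐ[K] (κ.restrict L h).layer n :=
    { toFun := fun x => ⟨absClosureEmbedding K L x, absClosureEmbedding_mem_layer_restrict κ L h n x.2⟩
      map_one' := Subtype.ext (by simp)
      map_mul' := fun x y => Subtype.ext (by simp)
      map_zero' := Subtype.ext (by simp)
      map_add' := fun x y => Subtype.ext (by simp)
      commutes' := fun r => Subtype.ext (by
        change absClosureEmbedding K L (algebraMap K (AlgebraicClosure K) r) = _
        rw [AlgHom.commutes]
        rfl) }
  refine ⟨φ, fun x y hxy => ?_, fun x => rfl⟩
  have h1 : absClosureEmbedding K L (x : AlgebraicClosure K) = absClosureEmbedding K L (y : AlgebraicClosure K) :=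
    congrArg (fun z : (κ.restrict L h).layer n => (z : AlgebraicClosure L)) hxy
  exact Subtype.ext ((absClosureEmbedding K L).toRingHom.injective h1)


/-- **`[L_n : K] = [L : K]·pⁿ`**: the `n`-th layer of `L·K_∞/L` has degree `[L:K]·pⁿ` over the base `K`
(`[L_n : L] = pⁿ`, `finrank_layer_holds`, and the tower `K ⊆ L ⊆ L_n`). [cite: Washington1997, §13.1] -/
theorem finrank_layer_restrict (κ : ZpExtension K p) (L : Type v) [Field L] [NumberField L] [Algebra K L]
    (h : Function.Surjective (κ.toContinuousMonoidHom.comp (absGaloisRestrict K L))) (n : ℕ) :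
    Module.finrank K ((κ.restrict L h).layer n) = Module.finrank K L * p ^ n := by
  rw [← (κ.restrict L h).finrank_layer_holds n]
  exact (Module.finrank_mul_finrank K L ((κ.restrict L h).layer n)).symm

/-- **`[L_n : K_n] = [L : K]`**: for ANY `K`-embedding `φ : K_n →ₐ[K] L_n` (e.g. the one over `ι` of
`exists_algHom_layer_restrict`), the layer `L_n` of `L·K_∞/L` has degree `[L : K]` over the image of the layer
`K_n` of `K_∞/K` (`[L_n : K] = [L:K]·pⁿ = [L_n : φK_n]·[K_n : K]`).  This is the degree half of «`L_n = L·K_n`,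
`L ∩ K_∞ = K`». [cite: Washington1997, §13.1] -/
theorem finrank_fieldRange_layer_restrict (κ : ZpExtension K p) (L : Type v) [Field L] [NumberField L]
    [Algebra K L] (h : Function.Surjective (κ.toContinuousMonoidHom.comp (absGaloisRestrict K L))) (n : ℕ)
    (φ : κ.layer n →ₐ[K] (κ.restrict L h).layer n) :
    Module.finrank φ.fieldRange ((κ.restrict L h).layer n) = Module.finrank K L := by
  have hp : 0 < p ^ n := pow_pos (Fact.out : p.Prime).pos n
  have h1 : Module.finrank K ((κ.restrict L h).layer n) = Module.finrank K L * p ^ n :=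
    finrank_layer_restrict κ L h n
  have h2 : Module.finrank K φ.fieldRange = p ^ n := by
    rw [← κ.finrank_layer_holds n]
    have e : κ.layer n ≃ₐ[K] φ.range := AlgEquiv.ofInjective φ φ.toRingHom.injective
    rw [e.toLinearEquiv.finrank_eq]
    rfl
  have h3 := Module.finrank_mul_finrank K φ.fieldRange ((κ.restrict L h).layer n)
  rw [h2, h1, mul_comm] at h3
  exact Nat.eq_of_mul_eq_mul_right hp h3

end Literature.NumberTheory.EllipticCurves.ZpExtension

end
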